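import Summits.HodgeConjecture.HodgeConjecture.Theorems.GenericDivisibilityGenericDivisibilityBoundedSupportedTop
import Summits.HodgeConjecture.HodgeConjecture.Theorems.GenericDivisibilityHodgeBoundedSuffices
import HarnessLib

/-!
# Route GenericDivisibility — crux C2 `GenericDivisibilityBounded` (stmt-HodgeConjecture-18467):
# under the Hodge conjecture for `X`, the heart of the line holds on the classes that are
# Hodge modulo coniveau one (with `w = 0`, at every prime and every level)

Line `finite-level-bootstrap`, registered sub-goal `stub_levelCleanOnHodgeOfHodgeConjectureFor`
(lead c5). Sorry-free, definition-free. `X` is smooth projective over `ℂ` of dimension `2p`,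
`p ≥ 1`, `H = H²ᵖ(X(ℂ); ℤ)`, `z| = z|_{(X∖Z)(ℂ)}`, `N¹ = supportedClasses X (2p) 1` (complex
classes dying on the complex points of a non-empty Zariski open), and (spelled inline, as in the
funnel file `…LevelCleanFunnel`) "`x` is GENERICALLY TORSION" (`x ∈ GT`) means `∃ Z` closed
`≠ univ`, `∃ N ≥ 1`, `N • x| = 0`.

The heart of the line at `(ℓ, s, X)` says `D'(ℓ^s, z) ⇒ ∃ w, z - ℓ • w ∈ GT`. This file proves it,
granted `HodgeConjectureFor (2p) X`, for the integral classes `z` that are **Hodge modulo coniveau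
one**: `z ⊗ ℂ ≡ h (mod N¹)` with `h` a RATIONAL class of Hodge type `(p, p)`. Indeed `h` is then
algebraic, `h ∈ algebraicClasses X p = Nᵖ H²ᵖ ⊆ N¹ H²ᵖ` (`supportedClasses_mono`, `p ≥ 1`), so
`z ⊗ ℂ = (z ⊗ ℂ - h) + h ∈ N¹`, and an integral class whose complexification has coniveau `≥ 1` is
generically torsion (the landed converse bridge `N¹ ∩ H_ℤ ⊆ GT`,
`genericDivisibilityBounded_exists_nsmul_restrict_eq_zero_of_ringChange_mem_supportedClasses`:
directedness of the generating kernels of `N¹`, Bloch–Ogus (3.8), and universal coefficients on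
`(X∖Z)(ℂ)` with Dimca's finiteness theorem, all PROVED in the tree). Hence `z ∈ GT` itself and
`w = 0` does it — the divisibility hypothesis `D'(ℓ^s, z)` is not used.

## Main results

* `genericDivisibilityBounded_genericallyTorsion_of_hodgeModConiveauOne_of_hodgeConjectureFor` —
  HC at `X` ⟹ every integral class that is Hodge modulo `N¹` is generically torsion;
* `stub_levelCleanOnHodgeOfHodgeConjectureFor` — the registered signature, verbatim: HC at `X` ⟹
  the heart at every `(ℓ, s)` on the classes that are Hodge modulo `N¹`, with `w = 0`.

References: [VoisinHodgeI2002] §11.3 Conj. 11.24; [GrothendieckTopology1969] §1;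
[BlochOgus1974ENS] (3.8); [Dimca1992] Ch. 1 Cor. (6.10).
-/

-- `Summit.HodgeConjecture.HodgeConjecture.Theorems` is the mandated namespace (single-problem
-- summit: Problem = Summit), which `linter.dupNamespace` flags on every declaration; the lakefile
-- turns the linter off tree-wide (weak option), restated here so stand-alone elaboration is
-- warning-free too.
set_option linter.dupNamespace false

noncomputable section

namespace Summit.HodgeConjecture.HodgeConjecture.Theorems

open CategoryTheory AlgebraicGeometry
open Literature.AlgebraicGeometry.Motives Literature.AlgebraicGeometry.HodgeTheory
  Literature.AlgebraicTopology.SingularHomology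

/-- Restriction `H^k(X(ℂ);ℤ) → H^k((X∖Z)(ℂ);ℤ)`, the very term of the route decls (notation only). -/
local notation3 (prettyPrint := false) "Res[" X ", " Z ", " k "]" =>
  singularCohomology.map ℤ ℤ
    (⟨Subtype.val, continuous_subtype_val⟩ : C(complexPointsCompl X Z, ComplexPoints X)) k

/-! ### HC at `X` ⟹ the classes that are Hodge modulo `N¹` are generically torsion -/

/-- **HC at `X` ⟹ `(Hodge mod N¹) ∩ H_ℤ ⊆ GT`.** On a smooth projective complex `2p`-fold `X`,
`p ≥ 1`, satisfying `HodgeConjectureFor (2 * p) X`: if an integral class `z ∈ H²ᵖ(X(ℂ);ℤ)` is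
Hodge modulo coniveau one — `z ⊗ ℂ - h ∈ N¹H²ᵖ(X(ℂ);ℂ)` for some RATIONAL class `h` of Hodge type
`(p, p)` — then `z` is killed by some `N ≥ 1` on the complex points of a non-empty Zariski open.
For `h ∈ algebraicClasses X p = Nᵖ ⊆ N¹` (HC, then `supportedClasses_mono` as `1 ≤ p`), so
`z ⊗ ℂ = (z ⊗ ℂ - h) + h ∈ N¹`, and `N¹ ∩ H_ℤ ⊆ GT`
(`genericDivisibilityBounded_exists_nsmul_restrict_eq_zero_of_ringChange_mem_supportedClasses`).
[cite: VoisinHodgeI2002, §11.3 Conj. 11.24] [cite: GrothendieckTopology1969, §1]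
[cite: BlochOgus1974ENS, (3.8)] -/
theorem genericDivisibilityBounded_genericallyTorsion_of_hodgeModConiveauOne_of_hodgeConjectureFor
    {p : ℕ} {X : SchemeOver ℂ} (hp : 1 ≤ p) (hX : IsSmoothProjective (2 * p) X)
    (hHC : HodgeConjectureFor (2 * p) X) (z : singularCohomology ℤ ℤ (ComplexPoints X) (2 * p))
    (hz : ∃ h : complexBetti X (2 * p), IsRationalClass h ∧ IsOfHodgeType (2 * p) X (2 * p) p p h ∧
      singularCohomology.ringChange (Int.castRingHom ℂ) (ComplexPoints X) (2 * p) z - h ∈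
        supportedClasses X (2 * p) 1) :
    ∃ Z : Set X.left, IsClosed Z ∧ Z ≠ Set.univ ∧ ∃ N : ℕ, 1 ≤ N ∧ N • Res[X, Z, 2 * p] z = 0 := by
  obtain ⟨h, hrat, hpp, hsub⟩ := hz
  -- `h` is algebraic by HC, hence in `Nᵖ ⊆ N¹`
  have hh : h ∈ supportedClasses X (2 * p) 1 :=
    supportedClasses_mono X (2 * p) hp (hHC.2 p h hrat hpp)
  -- so `z ⊗ ℂ = (z ⊗ ℂ - h) + h ∈ N¹`
  have hmem : singularCohomology.ringChange (Int.castRingHom ℂ) (ComplexPoints X) (2 * p) z ∈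
      supportedClasses X (2 * p) 1 := by
    simpa only [sub_add_cancel] using Submodule.add_mem _ hsub hh
  exact genericDivisibilityBounded_exists_nsmul_restrict_eq_zero_of_ringChange_mem_supportedClasses
    hX (by omega) hmem

/-! ### The registered sub-goal -/

/-- **Registered sub-goal `stub_levelCleanOnHodgeOfHodgeConjectureFor` of line
`finite-level-bootstrap` (crux C2, stmt-HodgeConjecture-18467), verbatim.** Under
`HodgeConjectureFor (2 * p) X` (`X` smooth projective of dimension `2p`, `p ≥ 1`), the heart of the
line "`D'(ℓ^s, z) ⇒ ∃ w, z - ℓ • w ∈ GT`" holds at EVERY prime `ℓ` and EVERY level `s` on the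
integral classes `z` that are Hodge modulo coniveau one (`z ⊗ ℂ ≡ h mod N¹`, `h` rational of type
`(p, p)`): such a `z` is itself generically torsion
(`genericDivisibilityBounded_genericallyTorsion_of_hodgeModConiveauOne_of_hodgeConjectureFor`), so
`w = 0` works; the divisibility hypothesis `D'(ℓ^s, z)` is not used.
[cite: VoisinHodgeI2002, §11.3 Conj. 11.24] [cite: BlochOgus1974ENS, (3.8)]
[cite: Dimca1992, Ch. 1 Cor. (6.10)] -/
theorem stub_levelCleanOnHodgeOfHodgeConjectureFor :
    ∀ ⦃p : ℕ⦄ ⦃X : SchemeOver ℂ⦄, 1 ≤ p → IsSmoothProjective (2 * p) X → HodgeConjectureFor (2 * p) X →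
      ∀ (ℓ s : ℕ) (z : singularCohomology ℤ ℤ (ComplexPoints X) (2 * p)),
        (∃ h : complexBetti X (2 * p), IsRationalClass h ∧ IsOfHodgeType (2 * p) X (2 * p) p p h ∧
          singularCohomology.ringChange (Int.castRingHom ℂ) (ComplexPoints X) (2 * p) z - h ∈
            supportedClasses X (2 * p) 1) →
        (∃ Z : Set X.left, IsClosed Z ∧ Z ≠ Set.univ ∧
          ∃ (y : singularCohomology ℤ ℤ (complexPointsCompl X Z) (2 * p)) (M : ℕ), 1 ≤ M ∧
            M • (singularCohomology.map ℤ ℤ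
              (⟨Subtype.val, continuous_subtype_val⟩ : C(complexPointsCompl X Z, ComplexPoints X))
              (2 * p) z - ℓ ^ s • y) = 0) →
        ∃ w : singularCohomology ℤ ℤ (ComplexPoints X) (2 * p),
          ∃ Z : Set X.left, IsClosed Z ∧ Z ≠ Set.univ ∧ ∃ N : ℕ, 1 ≤ N ∧
            N • singularCohomology.map ℤ ℤ
              (⟨Subtype.val, continuous_subtype_val⟩ : C(complexPointsCompl X Z, ComplexPoints X))
              (2 * p) (z - ℓ • w) = 0 := by
  intro p X hp hX hHC ℓ _ z hz _
  refine ⟨0, ?_⟩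
  rw [smul_zero, sub_zero]
  exact genericDivisibilityBounded_genericallyTorsion_of_hodgeModConiveauOne_of_hodgeConjectureFor
    hp hX hHC z hz

end Summit.HodgeConjecture.HodgeConjecture.Theorems

end
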